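import Summits.BirchSwinnertonDyer.Rank1Residual.Additive.X3BranchResidualCountOfCharacterFacts
import Mathlib.NumberTheory.LegendreSymbol.QuadraticChar.Basic
import HarnessLib

/-!
# The residual characters of the twist as PRODUCTS `(·/p)·φ`, `ψ·(·/p)` and as PRIMITIVE characters:
# values, conductors, and agreement off `p` (route K1 `AdditiveBranchIMC`, crux ReadingFacts, child
# 19297 `GreenbergVatsalResidualBranch` — supports only; seat `bsd-inputs-abimc-rf-p1`)

HONEST FRAMING (cell `bsd-addord`, `run/shared/lean/pub/bsd-addord/README.md` §4): THEOREMS ONLY (no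
`def`, no named fact, no `sorry`); nothing is booked; BSD is not proved by any of this. TOOL for the
kernel derivation of the reading fact `GreenbergVatsal2000.thm312_branch_…` (item 19297) from the
tree's typed Thm. (3.11) at `χ = (·/p)` (`…GreenbergVatsalResidualBranchOfPrint.lean`).

## What

Greenberg–Vatsal's twisted congruence `thm311_quadraticTwist_…` presents the residual characters of
`W[p] ≅ V[p] ⊗ χ` (`χ = (·/p)`, GV p. 28 "`φψ = ω`", §3 (26)–(28)) as the PRODUCTS
`φ' = (·/p)·φ` mod `p·m` and `ψ' = ψ·(·/p)` mod `d·p` of the characters `φ` mod `m`, `ψ` mod `d` of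
the good ordinary curve `V`; the character facts of GV pp. 41–42 want PRIMITIVE characters. For the
primitive characters `θ = φ'.primitiveCharacter`, `θ' = ψ'.primitiveCharacter` (Mathlib) this file
records the bookkeeping:

* `mul_changeLevel_apply_modN`, `primitiveCharacter_apply_modN` — values on the cyclotomic
  characters: `φ'(χ_{pm}(σ)) = (χ_p(σ)/p)·φ(χ_m(σ))`, `θ(χ_c(σ)) = φ'(χ_{pm}(σ))`;
* `dvd_conductor_mul_of_dvd` — a prime `ℓ ≠ p` of `m` divides `cond φ'` (`m = cond φ̃ ∣
  lcm(cond φ', cond (·/p))`, Mathlib `conductor_mul_dvd_lcm_conductor`, `conductor_changeLevel`);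
* `apply_eq_primitiveCharacter_apply_of_not_dvd` — `φ'(a) = θ(a)` for every integer `a` prime to
  `p` whose prime factors `ℓ ≠ p` dividing `m` … (the agreement hypotheses of
  `…CharacterLFunctionPresentation.lean`), in the two shapes used for `C` and for `D`.

References: [GreenbergVatsal2000] §2 p. 28, §3 pp. 41–42; [Washington1997] Ch. 3.
-/

set_option autoImplicit false
set_option linter.dupNamespace false

noncomputable section

open scoped Classical

namespace Summit.BirchSwinnertonDyer.BirchSwinnertonDyer.Theorems.AdditiveBranchIMCGreenbergVatsalResidualBranchCharacters

open NumberField IsDedekindDomain Field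
  Literature.NumberTheory.GaloisRepresentations Literature.NumberTheory.EllipticCurves
  Summit.BirchSwinnertonDyer.Rank1Residual.Additive

variable {p : ℕ} [hp : Fact p.Prime]

/-! ### §1 Values on the cyclotomic characters -/

/-- `(χ₁·χ₂)(χ_{n₁n₂}(σ)) = χ₁(χ_{n₁}(σ))·χ₂(χ_{n₂}(σ))` for Dirichlet characters lifted to the product
level (compatibility `χ_M ≡ χ_n (mod n)` of the cyclotomic characters). [folklore] -/
theorem mul_changeLevel_apply_modN {R : Type*} [CommMonoidWithZero R] {n₁ n₂ : ℕ} [NeZero n₁]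
    [NeZero n₂] (χ₁ : DirichletCharacter R n₁) (χ₂ : DirichletCharacter R n₂)
    (σ : absoluteGaloisGroup ℚ) :
    (DirichletCharacter.changeLevel (dvd_mul_right n₁ n₂) χ₁ *
        DirichletCharacter.changeLevel (dvd_mul_left n₂ n₁) χ₂)
      ((modNCyclotomicCharacter ℚ (n₁ * n₂) σ : (ZMod (n₁ * n₂))ˣ) : ZMod (n₁ * n₂)) =
      χ₁ ((modNCyclotomicCharacter ℚ n₁ σ : (ZMod n₁)ˣ) : ZMod n₁) *
        χ₂ ((modNCyclotomicCharacter ℚ n₂ σ : (ZMod n₂)ˣ) : ZMod n₂) := by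
  haveI : NeZero (n₁ * n₂) := ⟨mul_ne_zero (NeZero.ne n₁) (NeZero.ne n₂)⟩
  rw [MulChar.coeToFun_mul, Pi.mul_apply, DirichletCharacter.changeLevel_eq_cast_of_dvd,
    DirichletCharacter.changeLevel_eq_cast_of_dvd, ZMod.cast_eq_val, ZMod.cast_eq_val,
    X3Branch.natCast_val_modNCyclotomicCharacter_of_dvd (dvd_mul_right n₁ n₂),
    X3Branch.natCast_val_modNCyclotomicCharacter_of_dvd (dvd_mul_left n₂ n₁)]

/-- `θ(χ_c(σ)) = χ(χ_n(σ))` for the primitive character `θ` (conductor `c`) of `χ` mod `n`.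
[folklore] -/
theorem primitiveCharacter_apply_modN {R : Type*} [CommMonoidWithZero R] {n : ℕ} [NeZero n]
    (χ : DirichletCharacter R n) (σ : absoluteGaloisGroup ℚ) :
    haveI : NeZero χ.conductor := ⟨χ.conductor_ne_zero⟩
    χ.primitiveCharacter
        ((modNCyclotomicCharacter ℚ χ.conductor σ : (ZMod χ.conductor)ˣ) : ZMod χ.conductor) =
      χ ((modNCyclotomicCharacter ℚ n σ : (ZMod n)ˣ) : ZMod n) := by
  haveI : NeZero χ.conductor := ⟨χ.conductor_ne_zero⟩
  conv_rhs => rw [← DirichletCharacter.changeLevel_primitiveCharacter χ]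
  rw [DirichletCharacter.changeLevel_eq_cast_of_dvd, ZMod.cast_eq_val,
    X3Branch.natCast_val_modNCyclotomicCharacter_of_dvd χ.conductor_dvd_level]

/-! ### §2 Conductors -/

/-- **A prime `ℓ` of the level of the PRIMITIVE character `χ₂` (mod `n₂`) not dividing the level
`n₁` of `χ₁` divides the conductor of the product `χ̃₁·χ̃₂`** (both lifted to a common level `N`):
`n₂ = cond χ̃₂`, `χ̃₂ = (χ̃₁χ̃₂)·χ̃₁⁻¹`, `cond(χχ') ∣ lcm(cond χ, cond χ')` (Mathlib
`conductor_mul_dvd_lcm_conductor`, `conductor_changeLevel`, `conductor_inv`), and `cond χ̃₁⁻¹ ∣ n₁`.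
[cite: Washington1997, Ch. 3 (conductors of Dirichlet characters)] -/
theorem dvd_conductor_mul_of_dvd {R : Type*} [CommRing R] [IsDomain R] {n₁ n₂ N : ℕ} [NeZero n₁]
    [NeZero n₂] [NeZero N] (χ₁ : DirichletCharacter R n₁) {χ₂ : DirichletCharacter R n₂}
    (hχ₂ : χ₂.IsPrimitive) {ℓ : ℕ} (hℓ : ℓ.Prime) (hℓn₂ : ℓ ∣ n₂) (hℓn₁ : ¬ ℓ ∣ n₁)
    (h₁ : n₁ ∣ N) (h₂ : n₂ ∣ N) :
    ℓ ∣ (DirichletCharacter.changeLevel h₁ χ₁ * DirichletCharacter.changeLevel h₂ χ₂).conductor := by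
  set A := DirichletCharacter.changeLevel h₁ χ₁ with hA
  set B := DirichletCharacter.changeLevel h₂ χ₂ with hB
  have hB' : B = (A * B) * A⁻¹ := by rw [mul_comm A B, mul_inv_cancel_right]
  have hcondB : B.conductor = n₂ := by
    rw [hB, DirichletCharacter.conductor_changeLevel, hχ₂]
  have hdvd : n₂ ∣ Nat.lcm (A * B).conductor A⁻¹.conductor := by
    rw [← hcondB]
    conv_lhs => rw [hB']
    exact DirichletCharacter.conductor_mul_dvd_lcm_conductor _ _
  have hℓlcm : ℓ ∣ (A * B).conductor * A⁻¹.conductor :=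
    (hℓn₂.trans hdvd).trans (Nat.lcm_dvd_mul _ _)
  rcases (Nat.Prime.dvd_mul hℓ).mp hℓlcm with h | h
  · exact h
  · exfalso
    apply hℓn₁
    rw [DirichletCharacter.conductor_inv, hA, DirichletCharacter.conductor_changeLevel] at h
    exact h.trans χ₁.conductor_dvd_level

/-- The same with the primitive character as the FIRST factor. [cite: Washington1997, Ch. 3 (conductors of Dirichlet characters)] -/
theorem dvd_conductor_mul_of_dvd' {R : Type*} [CommRing R] [IsDomain R] {n₁ n₂ N : ℕ} [NeZero n₁]
    [NeZero n₂] [NeZero N] (χ₁ : DirichletCharacter R n₁) {χ₂ : DirichletCharacter R n₂}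
    (hχ₂ : χ₂.IsPrimitive) {ℓ : ℕ} (hℓ : ℓ.Prime) (hℓn₂ : ℓ ∣ n₂) (hℓn₁ : ¬ ℓ ∣ n₁)
    (h₁ : n₁ ∣ N) (h₂ : n₂ ∣ N) :
    ℓ ∣ (DirichletCharacter.changeLevel h₂ χ₂ * DirichletCharacter.changeLevel h₁ χ₁).conductor := by
  rw [mul_comm]
  exact dvd_conductor_mul_of_dvd χ₁ hχ₂ hℓ hℓn₂ hℓn₁ h₁ h₂

/-! ### §3 Agreement of a character with its primitive character -/

/-- A natural number prime to a modulus `n` gives a unit-valued agreement `χ(a) = χ₀(a)` with the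
primitive character. [folklore] -/
theorem apply_natCast_eq_primitiveCharacter_of_coprime {R : Type*} [CommMonoidWithZero R] {n : ℕ}
    [NeZero n] (χ : DirichletCharacter R n) {a : ℕ} (ha : a.Coprime n) :
    χ (a : ZMod n) = χ.primitiveCharacter (a : ZMod χ.conductor) := by
  have ha' : IsCoprime (a : ℤ) n := Nat.isCoprime_iff_coprime.mpr ha
  have h := DirichletCharacter.primitiveCharacter_apply_of_isCoprime χ ha'
  rw [Int.cast_natCast, Int.cast_natCast] at h
  exact h.symm

/-- If some prime divides both `a` and the level `n` AND the conductor, both values vanish: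
`χ(a) = 0 = χ₀(a)`. [folklore] -/
theorem apply_natCast_eq_primitiveCharacter_of_dvd {R : Type*} [CommMonoidWithZero R] [Nontrivial R]
    {n : ℕ} [NeZero n] (χ : DirichletCharacter R n) {a ℓ : ℕ} (hℓ : ℓ.Prime) (hℓa : ℓ ∣ a)
    (hℓn : ℓ ∣ n) (hℓc : ℓ ∣ χ.conductor) :
    χ (a : ZMod n) = χ.primitiveCharacter (a : ZMod χ.conductor) := by
  haveI : NeZero χ.conductor := ⟨χ.conductor_ne_zero⟩
  have h1 : ¬ IsUnit (a : ZMod n) := by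
    rw [ZMod.isUnit_iff_coprime]
    exact fun h ↦ hℓ.one_lt.ne' (Nat.eq_one_of_dvd_one (h ▸ Nat.dvd_gcd hℓa hℓn))
  have h2 : ¬ IsUnit (a : ZMod χ.conductor) := by
    rw [ZMod.isUnit_iff_coprime]
    exact fun h ↦ hℓ.one_lt.ne' (Nat.eq_one_of_dvd_one (h ▸ Nat.dvd_gcd hℓa hℓc))
  rw [MulChar.map_nonunit _ h1, MulChar.map_nonunit _ h2]

end Summit.BirchSwinnertonDyer.BirchSwinnertonDyer.Theorems.AdditiveBranchIMCGreenbergVatsalResidualBranchCharacters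

end
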